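import Mathlib
import Summits.HodgeConjecture.FermatCycles.HodgeFermatRowUZ1Eleven
import Summits.HodgeConjecture.FermatCycles.HodgeFermatRowsFinal

/-!
# THEOREM L at every prime `p ≥ 7` of a squarefree level divisible by 3: the pattern is (U, U) (`HodgeFermat/ElevenFinal.lean`; HF-G29f), then COROLLARY M — shape of a minimal counterexample to PROPOSITION D′: the primes ≥ 7 (`CorollaryM.lean`; HF-G29g)

Tree copy of 2 SMALL MODULES of the sibling cell's standalone package `run/shared/lean/pub/pub-hodgefermat/lean/HodgeFermat/`,
concatenated IN DEPENDENCY ORDER in one tree file (one gate round-trip instead of 2; the hub's import-level build backlog was ≈ 50 min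
per level when this file was assembled) — each module's body byte-identical to its source lines, its own `namespace … end` block kept:
  1. `HodgeFermat/ElevenFinal.lean` (84 lines, sha256 `b2f4a8904650e468…`), whole module, source lines 27–84 (all: `eleven_pattern`, `eleven_UU`, `ge_seven_UU`) — pub-hodgefermat `CERT.md` l.945, GATE HF-G29f; cell record `check/ElevenFinal_standalone.lean` sha256 `1a174e7dff46c773…`;
  2. `HodgeFermat/CorollaryM.lean` (175 lines, sha256 `369a175ac85257a3…`), whole module, source lines 26–175 (all: `prime_UU`, `gcd_dvd_fifteen`, `all_units`, `level_of_units`, `three_or_five_dvd`) — pub-hodgefermat `CERT.md` l.948, GATE HF-G29g; cell record `check/CorollaryM_standalone.lean` sha256 `473fdfae4fb70872…`;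
Filed by cell `pub-hfermat`, seat prover-1 gen-3, on the COORDINATOR KEEPER RULING of 2026-08-25 (gem sweep H1: take the
off-gate kernel theorem `thmFstar` through the gate) — here THEOREM F* of `tables/DPRIME-THEOREM.md` §9 IN FULL, i.e.
PROPOSITION D′(3N) and the descent (`HodgeFermat/PropDPrimeNFinal.lean`, GATE HF-G34), the last off-gate form of THEOREM F*
(its first two forms, `DecodingFinal.thmFstar` = F* at the prime levels and `ThmFstarNFinal.thmFstar` = F*(3N), landed on
2026-08-25 as `HodgeFermatThmFstar.lean` / `HodgeFermatThmFstarN.lean`, seats prover-1 gen-0 / gen-2); these modules are links of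
the import closure of `PropDPrimeNFinal.propDprime` (the sibling's KR-free chain: THEOREM L, COROLLARY M, THEOREM D6,
THEOREM U⁺, THEOREM KR6, THEOREM Z3U) on top of those landed chains.  Each source module is the sibling's module of record named in item 1–2 above; declarations are copied VERBATIM.
Deviations from the source modules, exhaustively: the `import` lines (tree modules `Summits.HodgeConjecture.FermatCycles.HodgeFermat*`
instead of `HodgeFermat.*`, hoisted to the top; the source `import` lines between the concatenated modules are dropped); this docstring
(replacing the modules' docstrings, all quoted below); none at file level beyond the concatenation itself; per module: (`CorollaryM`'s `import HodgeFermat.ElevenFinal` points inside this file)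
  — module 1 (`ElevenFinal.lean`): none besides these.
  — module 2 (`CorollaryM.lean`): none besides these.
Every other line — in particular every declaration's statement and proof — is byte-identical to its source.
HONEST FRAMING: explicit algebraic cycles for specific Hodge classes on Fermat/Delsarte varieties; residual open instances
listed; no claim on general Hodge.  (This file is arithmetic of CM types / finite combinatorics / analytic number theory
of the sibling's KR-free programme; it claims nothing about cycles.)

(1) The docstring of `HodgeFermat/ElevenFinal.lean` (l.4–25), verbatim:

## HodgeFermat/ElevenFinal.lean — generation 29 (fifth addendum, HF-G29f) of the hodge-fermat build

THEOREM L (`tables/DPRIME-THEOREM.md` §3), ROWS p ≥ 7, AS ONE KERNEL STATEMENT: "(U, U) ONLY".  The packaging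
`RowsFinal.pattern_of_rows` instantiated at p = 11 with the row `RowUZ1Eleven.row_UZ1_eleven` (generation 29c: squarefree n,
full joint primitivity, certificate F33) and `TheoremL.row_Z1Z1_eleven` gives `eleven_pattern` / `eleven_UU`; together with
`RowsFinal.seven_UU` (p = 7, HF-G29d/e/f) and `RowsFinal.thirteen_UU` (p ≥ 13) this is

**`ge_seven_UU` — THEOREM L, rows p ≥ 7, final form.**  Let m = pn, p ≥ 7 prime, p ∤ n, n squarefree odd; let
T = (a, b, c), T′ = (a′, b′, c′) be zero-sum triples of level m with no entry ≡ 0 (mod m), JOINTLY PRIMITIVE (no prime q ∣ m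
divides all six entries), DISJOINT (no entry of T congruent mod m to an entry of T′) and of the same CM type.  Then all six
entries are prime to p: the pattern at p is (U, U).  By hand THEOREM L states this for p ≥ 11 and allows "(Z1, Z1) with
5 ∣ n, 7y ≡ 7y′ (mod m/5)" at p = 7; in the kernel the p = 7 row is "(U, U) only" as well (squarefreeness is used at p = 11
only, through the DESCENT LEMMA).

Together with `RowsFinal.five_pattern` (row p = 5: no (Z3, U); (Z3, Z1) only with 3 ∣ n and the Z1 entry ≡ ±m/3) and THEOREM Z3U
`TheoremZ3U.z3u` (row p = 3: (Z3, U) forces m = 21; HF-G29), EVERY ROW of THEOREM L is a kernel statement.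

This module is NOT light (it imports `RowUZ1Eleven`, hence `Descent`, `CoincFull`, `TheoremZ3U`); the light statements live in
`RowsFinal.lean`.  No `sorry`; `decide +kernel` only inside the imported certificate `RowUZ1Eleven.f33Check_true`; no axiom
beyond [propext, Classical.choice, Quot.sound].

(2) The docstring of `HodgeFermat/CorollaryM.lean` (l.3–24), verbatim:

## HodgeFermat/CorollaryM.lean — generation 29 (sixth addendum, HF-G29g) of the hodge-fermat build

COROLLARY M (`tables/DPRIME-THEOREM.md` §5 — "shape of a minimal counterexample to Prop D′") IN THE KERNEL, in the form
the kernel rows of THEOREM L now give, for a DISJOINT JOINTLY PRIMITIVE coincidence of CM types `(T, T′)`,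
`T = (a, b, c)`, `T′ = (a′, b′, c′)`, at a SQUAREFREE ODD level `m` (zero sums, no entry `≡ 0 (mod m)`):

* `prime_UU` — at every prime `q ≥ 7` of `m` both triples are all-unit (the pattern at `q` is (U, U)); this is
  `ElevenFinal.ge_seven_UU` re-indexed by the level (`m = q · (m/q)`), and it SHARPENS the corollary's clause at 7
  ("(U, U) unless 5 ∣ m") to "(U, U)";
* `gcd_dvd_fifteen` — hence EVERY ENTRY `x` HAS `gcd(x, m) ∣ 15` (the corollary prints `∣ 105`);
* `all_units` — if no prime `q < 7` of `m` divides an entry, all six entries are units mod `m`;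
* `level_of_units` — [with THEOREM U⁺ as the hypothesis `ThmUPlus'` of the light module `TheoremUEq`, closed by
  generation 26's `thmUPlus` through `TheoremUEqFinal.thmUPlus'_iff`] if `5 ∤ m` and all six entries are prime to 3, then
  `m ∈ {21, 39}` (the corollary's last clause, with its proviso `gcd(m, 35) = 1` weakened to `5 ∤ m`);
* `three_or_five_dvd` — [same hypothesis] in particular `3 ∣ m` or `5 ∣ m`: a squarefree odd level prime to 15 carries
  no disjoint jointly primitive coincidence of CM types (a weak, KR-free form of Theorem S6's "levels prime to 6 carry no
  coincidence", obtained here from THEOREM L + THEOREM U alone).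

Imports `ElevenFinal` (hence the p = 11 cone with its kernel certificates).  No `sorry`, no new `decide`, no axiom beyond
[propext, Classical.choice, Quot.sound].
-/

/-! ## (1/2) `HodgeFermat/ElevenFinal.lean` — source lines 27–84 -/

set_option autoImplicit false

namespace HodgeFermat.KRFree.ElevenFinal

open HodgeFermat.KRFree.LemmaN HodgeFermat.KRFree.TheoremL HodgeFermat.KRFree.RowsFinal
open HodgeFermat.KRFree.RowUZ1Eleven (row_UZ1_eleven)

/-- **THEOREM L, row p = 11 (final form; n squarefree odd, 11 ∤ n, full joint primitivity).** -/
theorem eleven_pattern (n a b c a' b' c' : ℕ) (hsq : Squarefree n) (h11n : ¬ 11 ∣ n) (hodd : Odd n)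
    (hs : 11 * n ∣ a + b + c) (ha : ¬ 11 * n ∣ a) (hb : ¬ 11 * n ∣ b) (hc : ¬ 11 * n ∣ c)
    (hs' : 11 * n ∣ a' + b' + c') (ha' : ¬ 11 * n ∣ a') (hb' : ¬ 11 * n ∣ b') (hc' : ¬ 11 * n ∣ c')
    (hJ : ∀ q, Nat.Prime q → q ∣ 11 * n → q ∣ a → q ∣ b → q ∣ c → q ∣ a' → q ∣ b' → q ∣ c' → False)
    (hH : SameType (11 * n) (a, b, c) (a', b', c')) :
    (¬ 11 ∣ a ∧ ¬ 11 ∣ b ∧ ¬ 11 ∣ c ∧ ¬ 11 ∣ a' ∧ ¬ 11 ∣ b' ∧ ¬ 11 ∣ c') ∨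
    (∃ u v, (u = a ∨ u = b ∨ u = c) ∧ (v = a' ∨ v = b' ∨ v = c') ∧ 11 ∣ u ∧ 11 ∣ v ∧ u ≡ v [MOD 11 * n]) :=
  have hp : Nat.Prime 11 := by norm_num
  pattern_of_rows 11 n (fun _ => False) hp (by norm_num) h11n hodd.pos hodd not_false
    (fun y x₂ x₃ x' y' z' h1 h2 h3 h4 h5 h6 h7 h8 hj h9 =>
      row_UZ1_eleven n y x₂ x₃ x' y' z' hsq h11n hodd h1 h2 h3 h4 h5 h6 h7 h8 hj h9)
    (fun y x₂ x₃ y' x₂' x₃' h1 h2 h3 h4 h5 h6 h7 => by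
      by_contra hyy'
      exact row_Z1Z1_eleven 11 n y x₂ x₃ y' x₂' x₃' hp le_rfl h11n hodd.pos hodd h1 h2 h3 h4 h5 h6 hyy' h7)
    a b c a' b' c' hs ha hb hc hs' ha' hb' hc' hJ hH

/-- **THEOREM L, row p = 11: (U, U) ONLY** (n squarefree odd, 11 ∤ n; jointly primitive disjoint pair). -/
theorem eleven_UU (n a b c a' b' c' : ℕ) (hsq : Squarefree n) (h11n : ¬ 11 ∣ n) (hodd : Odd n)
    (hs : 11 * n ∣ a + b + c) (ha : ¬ 11 * n ∣ a) (hb : ¬ 11 * n ∣ b) (hc : ¬ 11 * n ∣ c)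
    (hs' : 11 * n ∣ a' + b' + c') (ha' : ¬ 11 * n ∣ a') (hb' : ¬ 11 * n ∣ b') (hc' : ¬ 11 * n ∣ c')
    (hJ : ∀ q, Nat.Prime q → q ∣ 11 * n → q ∣ a → q ∣ b → q ∣ c → q ∣ a' → q ∣ b' → q ∣ c' → False)
    (hD : ∀ u v, (u = a ∨ u = b ∨ u = c) → (v = a' ∨ v = b' ∨ v = c') → ¬ u ≡ v [MOD 11 * n])
    (hH : SameType (11 * n) (a, b, c) (a', b', c')) :
    ¬ 11 ∣ a ∧ ¬ 11 ∣ b ∧ ¬ 11 ∣ c ∧ ¬ 11 ∣ a' ∧ ¬ 11 ∣ b' ∧ ¬ 11 ∣ c' :=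
  (eleven_pattern n a b c a' b' c' hsq h11n hodd hs ha hb hc hs' ha' hb' hc' hJ hH).resolve_right
    fun ⟨u, v, hu, hv, _, _, huv⟩ => hD u v hu hv huv

/-- **THEOREM L, rows p ≥ 7, final form: (U, U) ONLY.**  For a prime p ≥ 7 and a squarefree odd n with p ∤ n: two zero-sum
triples of level `pn` with no entry `≡ 0 (mod pn)`, jointly primitive (no prime `q ∣ pn` divides all six entries), disjoint (no
entry of `T` congruent mod `pn` to an entry of `T′`) and of the same CM type have all six entries prime to p. -/
theorem ge_seven_UU (p n a b c a' b' c' : ℕ) (hp : p.Prime) (h7 : 7 ≤ p) (hpn : ¬ p ∣ n) (hsq : Squarefree n)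
    (hodd : Odd n)
    (hs : p * n ∣ a + b + c) (ha : ¬ p * n ∣ a) (hb : ¬ p * n ∣ b) (hc : ¬ p * n ∣ c)
    (hs' : p * n ∣ a' + b' + c') (ha' : ¬ p * n ∣ a') (hb' : ¬ p * n ∣ b') (hc' : ¬ p * n ∣ c')
    (hJ : ∀ q, Nat.Prime q → q ∣ p * n → q ∣ a → q ∣ b → q ∣ c → q ∣ a' → q ∣ b' → q ∣ c' → False)
    (hD : ∀ u v, (u = a ∨ u = b ∨ u = c) → (v = a' ∨ v = b' ∨ v = c') → ¬ u ≡ v [MOD p * n])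
    (hH : SameType (p * n) (a, b, c) (a', b', c')) :
    ¬ p ∣ a ∧ ¬ p ∣ b ∧ ¬ p ∣ c ∧ ¬ p ∣ a' ∧ ¬ p ∣ b' ∧ ¬ p ∣ c' := by
  have hn : 0 < n := hodd.pos
  have hJP : ¬ (p ∣ a ∧ p ∣ b ∧ p ∣ c ∧ p ∣ a' ∧ p ∣ b' ∧ p ∣ c') :=
    fun h => hJ p hp (dvd_mul_right p n) h.1 h.2.1 h.2.2.1 h.2.2.2.1 h.2.2.2.2.1 h.2.2.2.2.2
  rcases Nat.lt_or_ge p 13 with hlt | h13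
  · have hp' : p = 7 ∨ p = 11 := by
      interval_cases p <;> first | exact Or.inl rfl | exact Or.inr rfl | exact absurd hp (by norm_num)
    rcases hp' with rfl | rfl
    · exact seven_UU n a b c a' b' c' hpn hn hodd hs ha hb hc hs' ha' hb' hc' hJP hD hH
    · exact eleven_UU n a b c a' b' c' hsq hpn hodd hs ha hb hc hs' ha' hb' hc' hJ hD hH
  · exact thirteen_UU p n a b c a' b' c' hp h13 hpn hn hodd hs ha hb hc hs' ha' hb' hc' hJP hD hH

end HodgeFermat.KRFree.ElevenFinal

/-! ## (2/2) `HodgeFermat/CorollaryM.lean` — source lines 26–175 -/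

set_option autoImplicit false

namespace HodgeFermat.KRFree.CorollaryM

open HodgeFermat.KRFree.LemmaN
open HodgeFermat.KRFree.TheoremUEq (ThmUPlus')
open HodgeFermat.KRFree.ElevenFinal (ge_seven_UU)

/-- **COROLLARY M, clause "q ≥ 7": (U, U) at every prime q ≥ 7 of a squarefree odd level.** -/
theorem prime_UU (m a b c a' b' c' : ℕ) (hsq : Squarefree m) (hodd : Odd m)
    (hs : m ∣ a + b + c) (ha : ¬ m ∣ a) (hb : ¬ m ∣ b) (hc : ¬ m ∣ c)
    (hs' : m ∣ a' + b' + c') (ha' : ¬ m ∣ a') (hb' : ¬ m ∣ b') (hc' : ¬ m ∣ c')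
    (hJ : ∀ q, Nat.Prime q → q ∣ m → q ∣ a → q ∣ b → q ∣ c → q ∣ a' → q ∣ b' → q ∣ c' → False)
    (hD : ∀ u v, (u = a ∨ u = b ∨ u = c) → (v = a' ∨ v = b' ∨ v = c') → ¬ u ≡ v [MOD m])
    (hH : SameType m (a, b, c) (a', b', c'))
    (q : ℕ) (hq : q.Prime) (h7 : 7 ≤ q) (hqm : q ∣ m) :
    ¬ q ∣ a ∧ ¬ q ∣ b ∧ ¬ q ∣ c ∧ ¬ q ∣ a' ∧ ¬ q ∣ b' ∧ ¬ q ∣ c' := by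
  obtain ⟨n, rfl⟩ := hqm
  have hqn : ¬ q ∣ n := fun h =>
    hq.one_lt.ne' (Nat.isUnit_iff.mp (hsq q (Nat.mul_dvd_mul_left q h)))
  have hsqn : Squarefree n := Squarefree.squarefree_of_dvd (dvd_mul_left n q) hsq
  have hoddn : Odd n := (Nat.odd_mul.mp hodd).2
  exact ge_seven_UU q n a b c a' b' c' hq h7 hqn hsqn hoddn hs ha hb hc hs' ha' hb' hc' hJ hD hH

/-- **COROLLARY M, clause "gcd(x, m) ∣ 15" for every entry x** (sharper than the printed `∣ 105`). -/
theorem gcd_dvd_fifteen (m a b c a' b' c' : ℕ) (hsq : Squarefree m) (hodd : Odd m)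
    (hs : m ∣ a + b + c) (ha : ¬ m ∣ a) (hb : ¬ m ∣ b) (hc : ¬ m ∣ c)
    (hs' : m ∣ a' + b' + c') (ha' : ¬ m ∣ a') (hb' : ¬ m ∣ b') (hc' : ¬ m ∣ c')
    (hJ : ∀ q, Nat.Prime q → q ∣ m → q ∣ a → q ∣ b → q ∣ c → q ∣ a' → q ∣ b' → q ∣ c' → False)
    (hD : ∀ u v, (u = a ∨ u = b ∨ u = c) → (v = a' ∨ v = b' ∨ v = c') → ¬ u ≡ v [MOD m])
    (hH : SameType m (a, b, c) (a', b', c'))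
    (x : ℕ) (hx : x = a ∨ x = b ∨ x = c ∨ x = a' ∨ x = b' ∨ x = c') :
    Nat.gcd x m ∣ 15 := by
  have hU := prime_UU m a b c a' b' c' hsq hodd hs ha hb hc hs' ha' hb' hc' hJ hD hH
  have hg : Squarefree (Nat.gcd x m) := Squarefree.squarefree_of_dvd (Nat.gcd_dvd_right x m) hsq
  have h2m : ¬ 2 ∣ m := fun h => (Nat.not_even_iff_odd.mpr hodd) (even_iff_two_dvd.mpr h)
  have hsub : (Nat.gcd x m).primeFactors ⊆ ({3, 5} : Finset ℕ) := by
    intro p hp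
    rw [Nat.mem_primeFactors] at hp
    obtain ⟨hpp, hpg, -⟩ := hp
    have hpx : p ∣ x := hpg.trans (Nat.gcd_dvd_left x m)
    have hpm : p ∣ m := hpg.trans (Nat.gcd_dvd_right x m)
    have hp2 : p ≠ 2 := fun h => h2m (h ▸ hpm)
    have hlt : p < 7 := by
      by_contra h7
      have h := hU p hpp (Nat.le_of_not_lt h7) hpm
      rcases hx with rfl | rfl | rfl | rfl | rfl | rfl
      · exact h.1 hpx
      · exact h.2.1 hpx
      · exact h.2.2.1 hpx
      · exact h.2.2.2.1 hpx
      · exact h.2.2.2.2.1 hpx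
      · exact h.2.2.2.2.2 hpx
    have h2 := hpp.two_le
    interval_cases p
    · exact absurd rfl hp2
    · simp
    · exact absurd hpp (by norm_num)
    · simp
    · exact absurd hpp (by norm_num)
  calc Nat.gcd x m = ∏ p ∈ (Nat.gcd x m).primeFactors, p := (Nat.prod_primeFactors_of_squarefree hg).symm
    _ ∣ ∏ p ∈ ({3, 5} : Finset ℕ), p := Finset.prod_dvd_prod_of_subset _ _ _ hsub
    _ = 15 := by norm_num [Finset.prod_pair]

/-- **COROLLARY M, units clause:** if no prime `q < 7` of `m` divides any entry, all six entries are units mod `m`. -/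
theorem all_units (m a b c a' b' c' : ℕ) (hsq : Squarefree m) (hodd : Odd m)
    (hs : m ∣ a + b + c) (ha : ¬ m ∣ a) (hb : ¬ m ∣ b) (hc : ¬ m ∣ c)
    (hs' : m ∣ a' + b' + c') (ha' : ¬ m ∣ a') (hb' : ¬ m ∣ b') (hc' : ¬ m ∣ c')
    (hJ : ∀ q, Nat.Prime q → q ∣ m → q ∣ a → q ∣ b → q ∣ c → q ∣ a' → q ∣ b' → q ∣ c' → False)
    (hD : ∀ u v, (u = a ∨ u = b ∨ u = c) → (v = a' ∨ v = b' ∨ v = c') → ¬ u ≡ v [MOD m])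
    (hH : SameType m (a, b, c) (a', b', c'))
    (hsmall : ∀ q, Nat.Prime q → q ∣ m → q < 7 →
      ¬ q ∣ a ∧ ¬ q ∣ b ∧ ¬ q ∣ c ∧ ¬ q ∣ a' ∧ ¬ q ∣ b' ∧ ¬ q ∣ c') :
    Nat.Coprime a m ∧ Nat.Coprime b m ∧ Nat.Coprime c m ∧
      Nat.Coprime a' m ∧ Nat.Coprime b' m ∧ Nat.Coprime c' m := by
  have hU := prime_UU m a b c a' b' c' hsq hodd hs ha hb hc hs' ha' hb' hc' hJ hD hH
  have hall : ∀ q, Nat.Prime q → q ∣ m → ¬ q ∣ a ∧ ¬ q ∣ b ∧ ¬ q ∣ c ∧ ¬ q ∣ a' ∧ ¬ q ∣ b' ∧ ¬ q ∣ c' :=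
    fun q hq hqm => (Nat.lt_or_ge q 7).elim (hsmall q hq hqm) (fun h7 => hU q hq h7 hqm)
  have cop : ∀ x, (∀ q, Nat.Prime q → q ∣ m → ¬ q ∣ x) → Nat.Coprime x m :=
    fun x h => Nat.coprime_of_dvd fun k hk hkx hkm => h k hk hkm hkx
  exact ⟨cop a fun q hq hqm => (hall q hq hqm).1, cop b fun q hq hqm => (hall q hq hqm).2.1,
    cop c fun q hq hqm => (hall q hq hqm).2.2.1, cop a' fun q hq hqm => (hall q hq hqm).2.2.2.1,
    cop b' fun q hq hqm => (hall q hq hqm).2.2.2.2.1, cop c' fun q hq hqm => (hall q hq hqm).2.2.2.2.2⟩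

/-- **COROLLARY M, last clause (with THEOREM U⁺ as hypothesis `ThmUPlus'`):** at a squarefree odd level `m` with `5 ∤ m`,
a disjoint jointly primitive coincidence of CM types whose six entries are prime to 3 lives at `m = 21` or `m = 39`. -/
theorem level_of_units (hUplus : ThmUPlus') (m a b c a' b' c' : ℕ) (hsq : Squarefree m) (hodd : Odd m) (h5 : ¬ 5 ∣ m)
    (hs : m ∣ a + b + c) (ha : ¬ m ∣ a) (hb : ¬ m ∣ b) (hc : ¬ m ∣ c)
    (hs' : m ∣ a' + b' + c') (ha' : ¬ m ∣ a') (hb' : ¬ m ∣ b') (hc' : ¬ m ∣ c')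
    (hJ : ∀ q, Nat.Prime q → q ∣ m → q ∣ a → q ∣ b → q ∣ c → q ∣ a' → q ∣ b' → q ∣ c' → False)
    (hD : ∀ u v, (u = a ∨ u = b ∨ u = c) → (v = a' ∨ v = b' ∨ v = c') → ¬ u ≡ v [MOD m])
    (hH : SameType m (a, b, c) (a', b', c'))
    (h3 : ¬ 3 ∣ a ∧ ¬ 3 ∣ b ∧ ¬ 3 ∣ c ∧ ¬ 3 ∣ a' ∧ ¬ 3 ∣ b' ∧ ¬ 3 ∣ c') :
    m = 21 ∨ m = 39 := by
  have h2m : ¬ 2 ∣ m := fun h => (Nat.not_even_iff_odd.mpr hodd) (even_iff_two_dvd.mpr h)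
  have hsmall : ∀ q, Nat.Prime q → q ∣ m → q < 7 →
      ¬ q ∣ a ∧ ¬ q ∣ b ∧ ¬ q ∣ c ∧ ¬ q ∣ a' ∧ ¬ q ∣ b' ∧ ¬ q ∣ c' := by
    intro q hq hqm hlt
    have h2 := hq.two_le
    interval_cases q
    · exact absurd hqm h2m
    · exact h3
    · exact absurd hq (by norm_num)
    · exact absurd hqm h5
    · exact absurd hq (by norm_num)
  obtain ⟨ca, cb, cc, ca', cb', cc'⟩ :=
    all_units m a b c a' b' c' hsq hodd hs ha hb hc hs' ha' hb' hc' hJ hD hH hsmall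
  by_cases h21 : m = 21
  · exact Or.inl h21
  by_cases h39 : m = 39
  · exact Or.inr h39
  exfalso
  rcases hUplus m a b c a' b' c' h2m h21 h39 hs hs' ca cb cc ca' cb' cc' hH with h | h | h
  · exact hD a a' (Or.inl rfl) (Or.inl rfl) h
  · exact hD a b' (Or.inl rfl) (Or.inr (Or.inl rfl)) h
  · exact hD a c' (Or.inl rfl) (Or.inr (Or.inr rfl)) h

/-- **COROLLARY (with THEOREM U⁺ as hypothesis): a disjoint jointly primitive coincidence of CM types at a squarefree odd
level `m` forces `3 ∣ m` or `5 ∣ m`** — squarefree odd levels prime to 15 carry none. -/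
theorem three_or_five_dvd (hUplus : ThmUPlus') (m a b c a' b' c' : ℕ) (hsq : Squarefree m) (hodd : Odd m)
    (hs : m ∣ a + b + c) (ha : ¬ m ∣ a) (hb : ¬ m ∣ b) (hc : ¬ m ∣ c)
    (hs' : m ∣ a' + b' + c') (ha' : ¬ m ∣ a') (hb' : ¬ m ∣ b') (hc' : ¬ m ∣ c')
    (hJ : ∀ q, Nat.Prime q → q ∣ m → q ∣ a → q ∣ b → q ∣ c → q ∣ a' → q ∣ b' → q ∣ c' → False)
    (hD : ∀ u v, (u = a ∨ u = b ∨ u = c) → (v = a' ∨ v = b' ∨ v = c') → ¬ u ≡ v [MOD m])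
    (hH : SameType m (a, b, c) (a', b', c')) :
    3 ∣ m ∨ 5 ∣ m := by
  by_contra h35
  have h3 : ¬ 3 ∣ m := fun h => h35 (Or.inl h)
  have h5 : ¬ 5 ∣ m := fun h => h35 (Or.inr h)
  have h2m : ¬ 2 ∣ m := fun h => (Nat.not_even_iff_odd.mpr hodd) (even_iff_two_dvd.mpr h)
  have hsmall : ∀ q, Nat.Prime q → q ∣ m → q < 7 →
      ¬ q ∣ a ∧ ¬ q ∣ b ∧ ¬ q ∣ c ∧ ¬ q ∣ a' ∧ ¬ q ∣ b' ∧ ¬ q ∣ c' := by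
    intro q hq hqm hlt
    have h2 := hq.two_le
    interval_cases q
    · exact absurd hqm h2m
    · exact absurd hqm h3
    · exact absurd hq (by norm_num)
    · exact absurd hqm h5
    · exact absurd hq (by norm_num)
  obtain ⟨ca, cb, cc, ca', cb', cc'⟩ :=
    all_units m a b c a' b' c' hsq hodd hs ha hb hc hs' ha' hb' hc' hJ hD hH hsmall
  have h21 : m ≠ 21 := fun h => h3 (h ▸ ⟨7, rfl⟩)
  have h39 : m ≠ 39 := fun h => h3 (h ▸ ⟨13, rfl⟩)
  rcases hUplus m a b c a' b' c' h2m h21 h39 hs hs' ca cb cc ca' cb' cc' hH with h | h | h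
  · exact hD a a' (Or.inl rfl) (Or.inl rfl) h
  · exact hD a b' (Or.inl rfl) (Or.inr (Or.inl rfl)) h
  · exact hD a c' (Or.inl rfl) (Or.inr (Or.inr rfl)) h

end HodgeFermat.KRFree.CorollaryM
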